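import Summits.BirchSwinnertonDyer.BirchSwinnertonDyer.Theorems.SignedLowerHalvesKobayashiLowerHalfSemistableScope
import Summits.BirchSwinnertonDyer.Rank1Residual.Supersingular.KobayashiMainConjectureX6BSTWScopeThree
import Summits.BirchSwinnertonDyer.Rank1Residual.SecondDescent.CanaryTargetsClassCertificates
import Mathlib.Tactic.NormNum.LegendreSymbol
import HarnessLib

/-!
# Route `SignedLowerHalves`, crux `KobayashiLowerHalfSemistable` (item stmt-BirchSwinnertonDyer-19000): kernel-checked
# scope witnesses at `p = 3` for the A6 cells `12034a1`, `15755a1`, `16982a1`, `17917b1` and their Eisenstein halves MODULO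
# ONLY the `p = 3` tier binder (cell `bsd-ssimc`, seat `bsd-ssimc-k3-c2` gen 2; companion C of
# `…SemistableScopeThree.lean`; a `--supports … --as helper` file, closes nothing)

PARTITION (cell bsd-ssimc): X6 ∧ r = 0 (A6) × the 12 cells at `p = 3` (`a₃ = 0`; here 12034a1, 15755a1, 16982a1, 17917b1) —
types-the-object-of; closes NONE. THEOREMS ONLY. HONEST FRAMING: nothing here is a theorem about Kobayashi's
conjecture; the conditional theorems are MODULO the named OPEN binder
`Summit.BirchSwinnertonDyer.Rank1Residual.Supersingular.BurungaleSkinnerTianWan2024_thm13_scopedAtThree_OPEN` (source: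
the PREPRINT arXiv:2409.01350v2 resting at `p = 3` on the preprint [SV-S-Ohta], located residual (3-ii)♭,
REPORT-bstw-7 40fdbe7e627732c4); the witnesses themselves are UNCONDITIONAL kernel facts about explicit integers;
BSD is not proved by any of this; the crux stays OPEN; nothing is booked (RELAY-6).

Per cell (gen 0's F3 pattern, see `…SemistableScope.lean`): `#Ẽ(𝔽₃) = 4` (kernel count), `ClassX6 W 3` by cc-eng-4's
`classX6_three_of_intModel`, the scope witness `BSTWScope.HasWitness W 3` from decidable data via
`BSTWScope.hasWitness_of_kronecker` (bad primes confined by a factorisation certificate of `Δ`; the (ram) prime by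
Tate; Kronecker symbols by `norm_num`; the form class number `h(−D)` by `decide`), and `KobayashiLowerDivisibility W 3 ε`
for both signs modulo only the tier binder. Cells: `12034a1` (`q = 11`, `L = ℚ(√−71)`, `h = 7`), `15755a1` (`q = 23`, `L = ℚ(√−119)`, `h = 10`), `16982a1` (`q = 1213`, `L = ℚ(√−47)`, `h = 5`), `17917b1` (`q = 19`, `L = ℚ(√−359)`, `h = 19`).
Witness table: seat folder `scripts/p3_witnesses.json` (generator `scripts/gen_p3_witness_lean.py`, pure python < 1 s).

References: [BurungaleSkinnerTianWan2024] Thm 1.3, II §2.3 (PRE); [Kobayashi2003] Conjecture (p. 2); [Cox2013] Thm 2.13 /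
7.7(ii); [Cremona2006] Table 1; [SilvermanAEC2009] VII.5 Prop. 5.1.
-/

set_option autoImplicit false
set_option linter.dupNamespace false

noncomputable section

open scoped Classical

open WeierstrassCurve NumberField Literature.NumberTheory.EllipticCurves
  Literature.NumberTheory.EllipticCurves.Rank1Residual
  Literature.NumberTheory.EllipticCurves.Rank1Residual.X11RankOneCertificates
  Summit.BirchSwinnertonDyer.Rank1Residual.Supersingular
  Summit.BirchSwinnertonDyer.Rank1Residual.SecondDescent
  Summit.BirchSwinnertonDyer.Rank1Residual.X11b
  Summit.BirchSwinnertonDyer.BirchSwinnertonDyer.Rank1Residual.IntModel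

namespace Summit.BirchSwinnertonDyer.BirchSwinnertonDyer.Theorems

/-! ### `12034a1 @ 3` -/

/-- `#Ẽ(𝔽₃) = 4` for `12034a1` (`a₃ = 0`: good SUPERSINGULAR at `3`, and the X6 clause at `p = 3`; kernel count). [folklore] -/
theorem card_c12034a1_3 :
    Nat.card (((⟨1, -1, 0, -56738, -5228652⟩ : WeierstrassCurve ℤ).map
      (Int.castRingHom (ZMod 3))).toAffine.Point) = 4 :=
  natCard_point_eq_of_countPoints 1 (-1) 0 (-56738) (-5228652) 3 (by norm_num) (by decide +kernel)
    (by decide +kernel)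

/-- `ClassX6 W 3` for `12034a1` read off the integer model (`3 ∤ Δ`, `#Ẽ(𝔽₃) = 4`, `gcd(Δ, c₄) = 1`) by cc-eng-4's
`classX6_three_of_intModel`. [cite: Cremona2006, Table 1 (Cremona label 12034a1)] [cite: SilvermanAEC2009, VII.5 Prop. 5.1(a) and (b)] -/
theorem classX6_c12034a1_3 {W : WeierstrassCurve ℚ} [W.IsElliptic] [W.IsGloballyMinimal]
    (hWeq : W = ⟨1, -1, 0, -56738, -5228652⟩) : ClassX6 W 3 := by
  have hIW : integralModelInt W = ⟨1, -1, 0, -56738, -5228652⟩ :=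
    integralModelInt_eq_of_map_eq _ (by rw [hWeq]; ext <;> simp [WeierstrassCurve.map])
  exact classX6_three_of_intModel hIW (by decide +kernel) card_c12034a1_3 (by decide +kernel)

/-- **L-witness for `12034a1` at `p = 3`: `q = 11`, `L = ℚ(√−71)` (`h = 7`).** `12034a1 = [1, -1, 0, -56738, -5228652]` (Cremona's minimal model),
`N = 2·11·547`, `Δ_min = −2^21·11^5·547`; the (ram) prime at `3` is `q = 11` (`ord_11 Δ = 5`, `3 ∤ 5`); `−71` is a prime
fundamental discriminant `≡ 1 (mod 8)` with `(−71/ℓ) = +1` for `ℓ ∈ {3, 2, 547}` (split: `3` and the primes of `N/11`),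
`(−71/11) = −1` (inert), `(71, 6N) = 1`, and `h(−71) = 7`, `3 ∤ 7` (form class number by `decide`). Hence
`BSTWScope.HasWitness W 3`. Unconditional; per pair; closes nothing.
[cite: Cremona2006, Table 1 (Cremona label 12034a1)] [cite: Cox2013, Thm. 2.13 (h(−71) = 7 by reduced forms)] -/
theorem BSTWScope_hasWitness_c12034a1_3 {W : WeierstrassCurve ℚ} [W.IsElliptic] [W.IsGloballyMinimal]
    (hWeq : W = ⟨1, -1, 0, -56738, -5228652⟩) : BSTWScope.HasWitness W 3 := by
  haveI h11 : Fact (Nat.Prime 11) := ⟨by norm_num⟩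
  have hIW : integralModelInt W = ⟨1, -1, 0, -56738, -5228652⟩ :=
    integralModelInt_eq_of_map_eq _ (by rw [hWeq]; ext <;> simp [WeierstrassCurve.map])
  set Lp : List ℕ := [2, 11, 547] with hLp
  have hLprime : ∀ q ∈ Lp, q.Prime := by
    simp only [hLp, List.mem_cons, List.mem_nil_iff, or_false]
    rintro q (rfl | rfl | rfl) <;> norm_num
  have hΔE : ∀ q : ℕ, q.Prime → (q : ℤ) ∣ (⟨1, -1, 0, -56738, -5228652⟩ : WeierstrassCurve ℤ).Δ → q ∈ Lp :=
    forall_mem_of_natAbs_eq_prod_pow Lp [21, 5, 1] hLprime (by decide +kernel)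
  have hbadmem : ∀ ℓ : ℕ, (hℓ : ℓ.Prime) →
      (haveI : Fact ℓ.Prime := ⟨hℓ⟩; ¬ W.HasGoodReductionAtPrime ℓ) → ℓ ∈ Lp := by
    intro ℓ hℓ hbad
    haveI : Fact ℓ.Prime := ⟨hℓ⟩
    have hd := natCast_dvd_minimalDiscriminantInt_of_not_hasGoodReductionAtPrime (W := W) ℓ hbad
    rw [minimalDiscriminantInt_eq hIW] at hd
    exact hΔE ℓ hℓ hd
  have haux : BSTWScope.IsAuxiliaryPrime W 3 11 := by
    refine ⟨by decide, hasMultiplicativeReductionAtPrime_of_intModel hIW 11 (by decide +kernel)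
      (by decide +kernel), ?_⟩
    rw [minimalDiscriminantInt_eq hIW,
      padicValInt_eq_of_dvd_of_not_dvd 11 (e := 5) (by decide +kernel) (by decide +kernel)]
    decide
  refine BSTWScope.hasWitness_of_kronecker W 3 (by decide) 11 haux 71 ⟨by norm_num, ?_, by norm_num⟩
    (by norm_num) (by norm_num) ?_ ?_ (fun _ => by norm_num) ?_
  · exact Int.squarefree_natAbs.mp (by simpa using (by norm_num : Nat.Prime 71).squarefree)
  · intro ℓ hℓ hbad
    have hmem := hbadmem ℓ hℓ hbad
    simp only [hLp, List.mem_cons, List.mem_nil_iff, or_false] at hmem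
    rcases hmem with rfl | rfl | rfl <;> decide
  · intro ℓ hℓ hℓq hbad
    have hmem := hbadmem ℓ hℓ hbad
    simp only [hLp, List.mem_cons, List.mem_nil_iff, or_false] at hmem
    rcases hmem with rfl | rfl | rfl
    · exact ⟨fun _ => by norm_num, fun h => absurd rfl h⟩
    · exact absurd rfl hℓq
    · exact ⟨fun h => absurd h (by decide), fun _ => by norm_num⟩
  · have h7 : Literature.NumberTheory.QuadraticFields.BinaryQuadraticForm.classNumber (-(71 : ℕ) : ℤ) = 7 := by
      decide +kernel
    rw [h7]; decide

/-- **The Eisenstein half of Kobayashi's main conjecture for `12034a1` at `p = 3`, BOTH signs, MODULO ONLY the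
p = 3 tier binder** (`hBSTW : BurungaleSkinnerTianWan2024_thm13_scopedAtThree_OPEN`, PRE resting on (3-ii)♭): the
scope witness is the kernel theorem `BSTWScope_hasWitness_c12034a1_3`, the class is `classX6_c12034a1_3`. One of the 12 A6
cells of the window at `p = 3` (TARGET §1.1). CONDITIONAL on the PRE binder only; per pair; closes nothing; NOT bookable
on cell verification (RELAY-6). [claim: BurungaleSkinnerTianWan2024, status: under-review]
[cite: Cremona2006, Table 1 (Cremona label 12034a1)] -/
theorem kobayashiLowerDivisibility_c12034a1_3_of_thm13_scopedAtThree_OPEN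
    (hBSTW : BurungaleSkinnerTianWan2024_thm13_scopedAtThree_OPEN)
    {W : WeierstrassCurve ℚ} [W.IsElliptic] [W.IsGloballyMinimal]
    (hWeq : W = ⟨1, -1, 0, -56738, -5228652⟩) (ε : ℤˣ) :
    Summit.BirchSwinnertonDyer.Rank1Residual.Supersingular.KobayashiLowerDivisibility W 3 ε :=
  X6.kobayashiLowerDivisibility_of_thm13_scopedAtThree_OPEN W 3 hBSTW rfl (classX6_c12034a1_3 hWeq)
    (BSTWScope_hasWitness_c12034a1_3 hWeq) ε

/-! ### `15755a1 @ 3` -/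

/-- `#Ẽ(𝔽₃) = 4` for `15755a1` (`a₃ = 0`: good SUPERSINGULAR at `3`, and the X6 clause at `p = 3`; kernel count). [folklore] -/
theorem card_c15755a1_3 :
    Nat.card (((⟨0, 0, 1, -376928, -139608542⟩ : WeierstrassCurve ℤ).map
      (Int.castRingHom (ZMod 3))).toAffine.Point) = 4 :=
  natCard_point_eq_of_countPoints 0 0 1 (-376928) (-139608542) 3 (by norm_num) (by decide +kernel)
    (by decide +kernel)

/-- `ClassX6 W 3` for `15755a1` read off the integer model (`3 ∤ Δ`, `#Ẽ(𝔽₃) = 4`, `gcd(Δ, c₄) = 1`) by cc-eng-4's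
`classX6_three_of_intModel`. [cite: Cremona2006, Table 1 (Cremona label 15755a1)] [cite: SilvermanAEC2009, VII.5 Prop. 5.1(a) and (b)] -/
theorem classX6_c15755a1_3 {W : WeierstrassCurve ℚ} [W.IsElliptic] [W.IsGloballyMinimal]
    (hWeq : W = ⟨0, 0, 1, -376928, -139608542⟩) : ClassX6 W 3 := by
  have hIW : integralModelInt W = ⟨0, 0, 1, -376928, -139608542⟩ :=
    integralModelInt_eq_of_map_eq _ (by rw [hWeq]; ext <;> simp [WeierstrassCurve.map])
  exact classX6_three_of_intModel hIW (by decide +kernel) card_c15755a1_3 (by decide +kernel)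

/-- **L-witness for `15755a1` at `p = 3`: `q = 23`, `L = ℚ(√−119)` (`h = 10`).** `15755a1 = [0, 0, 1, -376928, -139608542]` (Cremona's minimal model),
`N = 5·23·137`, `Δ_min = −5^7·23^7·137^2`; the (ram) prime at `3` is `q = 23` (`ord_23 Δ = 7`, `3 ∤ 7`); `−119` is a squarefree (`119 = 7·17`)
fundamental discriminant `≡ 1 (mod 8)` with `(−119/ℓ) = +1` for `ℓ ∈ {3, 5, 137}` (split: `3` and the primes of `N/23`),
`(−119/23) = −1` (inert), `(119, 6N) = 1`, and `h(−119) = 10`, `3 ∤ 10` (form class number by `decide`). Hence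
`BSTWScope.HasWitness W 3`. Unconditional; per pair; closes nothing.
[cite: Cremona2006, Table 1 (Cremona label 15755a1)] [cite: Cox2013, Thm. 2.13 (h(−119) = 10 by reduced forms)] -/
theorem BSTWScope_hasWitness_c15755a1_3 {W : WeierstrassCurve ℚ} [W.IsElliptic] [W.IsGloballyMinimal]
    (hWeq : W = ⟨0, 0, 1, -376928, -139608542⟩) : BSTWScope.HasWitness W 3 := by
  haveI h23 : Fact (Nat.Prime 23) := ⟨by norm_num⟩
  have hIW : integralModelInt W = ⟨0, 0, 1, -376928, -139608542⟩ :=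
    integralModelInt_eq_of_map_eq _ (by rw [hWeq]; ext <;> simp [WeierstrassCurve.map])
  set Lp : List ℕ := [5, 23, 137] with hLp
  have hLprime : ∀ q ∈ Lp, q.Prime := by
    simp only [hLp, List.mem_cons, List.mem_nil_iff, or_false]
    rintro q (rfl | rfl | rfl) <;> norm_num
  have hΔE : ∀ q : ℕ, q.Prime → (q : ℤ) ∣ (⟨0, 0, 1, -376928, -139608542⟩ : WeierstrassCurve ℤ).Δ → q ∈ Lp :=
    forall_mem_of_natAbs_eq_prod_pow Lp [7, 7, 2] hLprime (by decide +kernel)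
  have hbadmem : ∀ ℓ : ℕ, (hℓ : ℓ.Prime) →
      (haveI : Fact ℓ.Prime := ⟨hℓ⟩; ¬ W.HasGoodReductionAtPrime ℓ) → ℓ ∈ Lp := by
    intro ℓ hℓ hbad
    haveI : Fact ℓ.Prime := ⟨hℓ⟩
    have hd := natCast_dvd_minimalDiscriminantInt_of_not_hasGoodReductionAtPrime (W := W) ℓ hbad
    rw [minimalDiscriminantInt_eq hIW] at hd
    exact hΔE ℓ hℓ hd
  have haux : BSTWScope.IsAuxiliaryPrime W 3 23 := by
    refine ⟨by decide, hasMultiplicativeReductionAtPrime_of_intModel hIW 23 (by decide +kernel)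
      (by decide +kernel), ?_⟩
    rw [minimalDiscriminantInt_eq hIW,
      padicValInt_eq_of_dvd_of_not_dvd 23 (e := 7) (by decide +kernel) (by decide +kernel)]
    decide
  refine BSTWScope.hasWitness_of_kronecker W 3 (by decide) 23 haux 119 ⟨by norm_num, ?_, by norm_num⟩
    (by norm_num) (by norm_num) ?_ ?_ (fun _ => by norm_num) ?_
  · have hsq : Squarefree ((7 : ℕ) * 17) :=
      (Nat.squarefree_mul (by norm_num)).mpr
        ⟨(by norm_num : Nat.Prime 7).squarefree, (by norm_num : Nat.Prime 17).squarefree⟩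
    exact Int.squarefree_natAbs.mp (by simpa using hsq)
  · intro ℓ hℓ hbad
    have hmem := hbadmem ℓ hℓ hbad
    simp only [hLp, List.mem_cons, List.mem_nil_iff, or_false] at hmem
    rcases hmem with rfl | rfl | rfl <;> decide
  · intro ℓ hℓ hℓq hbad
    have hmem := hbadmem ℓ hℓ hbad
    simp only [hLp, List.mem_cons, List.mem_nil_iff, or_false] at hmem
    rcases hmem with rfl | rfl | rfl
    · exact ⟨fun h => absurd h (by decide), fun _ => by norm_num⟩
    · exact absurd rfl hℓq
    · exact ⟨fun h => absurd h (by decide), fun _ => by norm_num⟩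
  · have h10 : Literature.NumberTheory.QuadraticFields.BinaryQuadraticForm.classNumber (-(119 : ℕ) : ℤ) = 10 := by
      decide +kernel
    rw [h10]; decide

/-- **The Eisenstein half of Kobayashi's main conjecture for `15755a1` at `p = 3`, BOTH signs, MODULO ONLY the
p = 3 tier binder** (`hBSTW : BurungaleSkinnerTianWan2024_thm13_scopedAtThree_OPEN`, PRE resting on (3-ii)♭): the
scope witness is the kernel theorem `BSTWScope_hasWitness_c15755a1_3`, the class is `classX6_c15755a1_3`. One of the 12 A6
cells of the window at `p = 3` (TARGET §1.1). CONDITIONAL on the PRE binder only; per pair; closes nothing; NOT bookable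
on cell verification (RELAY-6). [claim: BurungaleSkinnerTianWan2024, status: under-review]
[cite: Cremona2006, Table 1 (Cremona label 15755a1)] -/
theorem kobayashiLowerDivisibility_c15755a1_3_of_thm13_scopedAtThree_OPEN
    (hBSTW : BurungaleSkinnerTianWan2024_thm13_scopedAtThree_OPEN)
    {W : WeierstrassCurve ℚ} [W.IsElliptic] [W.IsGloballyMinimal]
    (hWeq : W = ⟨0, 0, 1, -376928, -139608542⟩) (ε : ℤˣ) :
    Summit.BirchSwinnertonDyer.Rank1Residual.Supersingular.KobayashiLowerDivisibility W 3 ε :=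
  X6.kobayashiLowerDivisibility_of_thm13_scopedAtThree_OPEN W 3 hBSTW rfl (classX6_c15755a1_3 hWeq)
    (BSTWScope_hasWitness_c15755a1_3 hWeq) ε

/-! ### `16982a1 @ 3` -/

/-- `#Ẽ(𝔽₃) = 4` for `16982a1` (`a₃ = 0`: good SUPERSINGULAR at `3`, and the X6 clause at `p = 3`; kernel count). [folklore] -/
theorem card_c16982a1_3 :
    Nat.card (((⟨1, -1, 0, -25877, -1595787⟩ : WeierstrassCurve ℤ).map
      (Int.castRingHom (ZMod 3))).toAffine.Point) = 4 :=
  natCard_point_eq_of_countPoints 1 (-1) 0 (-25877) (-1595787) 3 (by norm_num) (by decide +kernel)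
    (by decide +kernel)

/-- `ClassX6 W 3` for `16982a1` read off the integer model (`3 ∤ Δ`, `#Ẽ(𝔽₃) = 4`, `gcd(Δ, c₄) = 1`) by cc-eng-4's
`classX6_three_of_intModel`. [cite: Cremona2006, Table 1 (Cremona label 16982a1)] [cite: SilvermanAEC2009, VII.5 Prop. 5.1(a) and (b)] -/
theorem classX6_c16982a1_3 {W : WeierstrassCurve ℚ} [W.IsElliptic] [W.IsGloballyMinimal]
    (hWeq : W = ⟨1, -1, 0, -25877, -1595787⟩) : ClassX6 W 3 := by
  have hIW : integralModelInt W = ⟨1, -1, 0, -25877, -1595787⟩ :=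
    integralModelInt_eq_of_map_eq _ (by rw [hWeq]; ext <;> simp [WeierstrassCurve.map])
  exact classX6_three_of_intModel hIW (by decide +kernel) card_c16982a1_3 (by decide +kernel)

/-- **L-witness for `16982a1` at `p = 3`: `q = 1213`, `L = ℚ(√−47)` (`h = 5`).** `16982a1 = [1, -1, 0, -25877, -1595787]` (Cremona's minimal model),
`N = 2·7·1213`, `Δ_min = −2^12·7·1213^2`; the (ram) prime at `3` is `q = 1213` (`ord_1213 Δ = 2`, `3 ∤ 2`); `−47` is a prime
fundamental discriminant `≡ 1 (mod 8)` with `(−47/ℓ) = +1` for `ℓ ∈ {3, 2, 7}` (split: `3` and the primes of `N/1213`),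
`(−47/1213) = −1` (inert), `(47, 6N) = 1`, and `h(−47) = 5`, `3 ∤ 5` (form class number by `decide`). Hence
`BSTWScope.HasWitness W 3`. Unconditional; per pair; closes nothing.
[cite: Cremona2006, Table 1 (Cremona label 16982a1)] [cite: Cox2013, Thm. 2.13 (h(−47) = 5 by reduced forms)] -/
theorem BSTWScope_hasWitness_c16982a1_3 {W : WeierstrassCurve ℚ} [W.IsElliptic] [W.IsGloballyMinimal]
    (hWeq : W = ⟨1, -1, 0, -25877, -1595787⟩) : BSTWScope.HasWitness W 3 := by
  haveI h1213 : Fact (Nat.Prime 1213) := ⟨by norm_num⟩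
  have hIW : integralModelInt W = ⟨1, -1, 0, -25877, -1595787⟩ :=
    integralModelInt_eq_of_map_eq _ (by rw [hWeq]; ext <;> simp [WeierstrassCurve.map])
  set Lp : List ℕ := [2, 7, 1213] with hLp
  have hLprime : ∀ q ∈ Lp, q.Prime := by
    simp only [hLp, List.mem_cons, List.mem_nil_iff, or_false]
    rintro q (rfl | rfl | rfl) <;> norm_num
  have hΔE : ∀ q : ℕ, q.Prime → (q : ℤ) ∣ (⟨1, -1, 0, -25877, -1595787⟩ : WeierstrassCurve ℤ).Δ → q ∈ Lp :=
    forall_mem_of_natAbs_eq_prod_pow Lp [12, 1, 2] hLprime (by decide +kernel)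
  have hbadmem : ∀ ℓ : ℕ, (hℓ : ℓ.Prime) →
      (haveI : Fact ℓ.Prime := ⟨hℓ⟩; ¬ W.HasGoodReductionAtPrime ℓ) → ℓ ∈ Lp := by
    intro ℓ hℓ hbad
    haveI : Fact ℓ.Prime := ⟨hℓ⟩
    have hd := natCast_dvd_minimalDiscriminantInt_of_not_hasGoodReductionAtPrime (W := W) ℓ hbad
    rw [minimalDiscriminantInt_eq hIW] at hd
    exact hΔE ℓ hℓ hd
  have haux : BSTWScope.IsAuxiliaryPrime W 3 1213 := by
    refine ⟨by decide, hasMultiplicativeReductionAtPrime_of_intModel hIW 1213 (by decide +kernel)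
      (by decide +kernel), ?_⟩
    rw [minimalDiscriminantInt_eq hIW,
      padicValInt_eq_of_dvd_of_not_dvd 1213 (e := 2) (by decide +kernel) (by decide +kernel)]
    decide
  refine BSTWScope.hasWitness_of_kronecker W 3 (by decide) 1213 haux 47 ⟨by norm_num, ?_, by norm_num⟩
    (by norm_num) (by norm_num) ?_ ?_ (fun _ => by norm_num) ?_
  · exact Int.squarefree_natAbs.mp (by simpa using (by norm_num : Nat.Prime 47).squarefree)
  · intro ℓ hℓ hbad
    have hmem := hbadmem ℓ hℓ hbad
    simp only [hLp, List.mem_cons, List.mem_nil_iff, or_false] at hmem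
    rcases hmem with rfl | rfl | rfl <;> decide
  · intro ℓ hℓ hℓq hbad
    have hmem := hbadmem ℓ hℓ hbad
    simp only [hLp, List.mem_cons, List.mem_nil_iff, or_false] at hmem
    rcases hmem with rfl | rfl | rfl
    · exact ⟨fun _ => by norm_num, fun h => absurd rfl h⟩
    · exact ⟨fun h => absurd h (by decide), fun _ => by norm_num⟩
    · exact absurd rfl hℓq
  · have h5 : Literature.NumberTheory.QuadraticFields.BinaryQuadraticForm.classNumber (-(47 : ℕ) : ℤ) = 5 := by
      decide +kernel
    rw [h5]; decide

/-- **The Eisenstein half of Kobayashi's main conjecture for `16982a1` at `p = 3`, BOTH signs, MODULO ONLY the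
p = 3 tier binder** (`hBSTW : BurungaleSkinnerTianWan2024_thm13_scopedAtThree_OPEN`, PRE resting on (3-ii)♭): the
scope witness is the kernel theorem `BSTWScope_hasWitness_c16982a1_3`, the class is `classX6_c16982a1_3`. One of the 12 A6
cells of the window at `p = 3` (TARGET §1.1). CONDITIONAL on the PRE binder only; per pair; closes nothing; NOT bookable
on cell verification (RELAY-6). [claim: BurungaleSkinnerTianWan2024, status: under-review]
[cite: Cremona2006, Table 1 (Cremona label 16982a1)] -/
theorem kobayashiLowerDivisibility_c16982a1_3_of_thm13_scopedAtThree_OPEN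
    (hBSTW : BurungaleSkinnerTianWan2024_thm13_scopedAtThree_OPEN)
    {W : WeierstrassCurve ℚ} [W.IsElliptic] [W.IsGloballyMinimal]
    (hWeq : W = ⟨1, -1, 0, -25877, -1595787⟩) (ε : ℤˣ) :
    Summit.BirchSwinnertonDyer.Rank1Residual.Supersingular.KobayashiLowerDivisibility W 3 ε :=
  X6.kobayashiLowerDivisibility_of_thm13_scopedAtThree_OPEN W 3 hBSTW rfl (classX6_c16982a1_3 hWeq)
    (BSTWScope_hasWitness_c16982a1_3 hWeq) ε

/-! ### `17917b1 @ 3` -/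

/-- `#Ẽ(𝔽₃) = 4` for `17917b1` (`a₃ = 0`: good SUPERSINGULAR at `3`, and the X6 clause at `p = 3`; kernel count). [folklore] -/
theorem card_c17917b1_3 :
    Nat.card (((⟨0, 0, 1, -6671, -209767⟩ : WeierstrassCurve ℤ).map
      (Int.castRingHom (ZMod 3))).toAffine.Point) = 4 :=
  natCard_point_eq_of_countPoints 0 0 1 (-6671) (-209767) 3 (by norm_num) (by decide +kernel)
    (by decide +kernel)

/-- `ClassX6 W 3` for `17917b1` read off the integer model (`3 ∤ Δ`, `#Ẽ(𝔽₃) = 4`, `gcd(Δ, c₄) = 1`) by cc-eng-4's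
`classX6_three_of_intModel`. [cite: Cremona2006, Table 1 (Cremona label 17917b1)] [cite: SilvermanAEC2009, VII.5 Prop. 5.1(a) and (b)] -/
theorem classX6_c17917b1_3 {W : WeierstrassCurve ℚ} [W.IsElliptic] [W.IsGloballyMinimal]
    (hWeq : W = ⟨0, 0, 1, -6671, -209767⟩) : ClassX6 W 3 := by
  have hIW : integralModelInt W = ⟨0, 0, 1, -6671, -209767⟩ :=
    integralModelInt_eq_of_map_eq _ (by rw [hWeq]; ext <;> simp [WeierstrassCurve.map])
  exact classX6_three_of_intModel hIW (by decide +kernel) card_c17917b1_3 (by decide +kernel)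

/-- **L-witness for `17917b1` at `p = 3`: `q = 19`, `L = ℚ(√−359)` (`h = 19`).** `17917b1 = [0, 0, 1, -6671, -209767]` (Cremona's minimal model),
`N = 19·23·41`, `Δ_min = −19·23^4·41^2`; the (ram) prime at `3` is `q = 19` (`ord_19 Δ = 1`, `3 ∤ 1`); `−359` is a prime
fundamental discriminant `≡ 1 (mod 8)` with `(−359/ℓ) = +1` for `ℓ ∈ {3, 23, 41}` (split: `3` and the primes of `N/19`),
`(−359/19) = −1` (inert), `(359, 6N) = 1`, and `h(−359) = 19`, `3 ∤ 19` (form class number by `decide`). Hence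
`BSTWScope.HasWitness W 3`. Unconditional; per pair; closes nothing.
[cite: Cremona2006, Table 1 (Cremona label 17917b1)] [cite: Cox2013, Thm. 2.13 (h(−359) = 19 by reduced forms)] -/
theorem BSTWScope_hasWitness_c17917b1_3 {W : WeierstrassCurve ℚ} [W.IsElliptic] [W.IsGloballyMinimal]
    (hWeq : W = ⟨0, 0, 1, -6671, -209767⟩) : BSTWScope.HasWitness W 3 := by
  haveI h19 : Fact (Nat.Prime 19) := ⟨by norm_num⟩
  have hIW : integralModelInt W = ⟨0, 0, 1, -6671, -209767⟩ :=
    integralModelInt_eq_of_map_eq _ (by rw [hWeq]; ext <;> simp [WeierstrassCurve.map])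
  set Lp : List ℕ := [19, 23, 41] with hLp
  have hLprime : ∀ q ∈ Lp, q.Prime := by
    simp only [hLp, List.mem_cons, List.mem_nil_iff, or_false]
    rintro q (rfl | rfl | rfl) <;> norm_num
  have hΔE : ∀ q : ℕ, q.Prime → (q : ℤ) ∣ (⟨0, 0, 1, -6671, -209767⟩ : WeierstrassCurve ℤ).Δ → q ∈ Lp :=
    forall_mem_of_natAbs_eq_prod_pow Lp [1, 4, 2] hLprime (by decide +kernel)
  have hbadmem : ∀ ℓ : ℕ, (hℓ : ℓ.Prime) →
      (haveI : Fact ℓ.Prime := ⟨hℓ⟩; ¬ W.HasGoodReductionAtPrime ℓ) → ℓ ∈ Lp := by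
    intro ℓ hℓ hbad
    haveI : Fact ℓ.Prime := ⟨hℓ⟩
    have hd := natCast_dvd_minimalDiscriminantInt_of_not_hasGoodReductionAtPrime (W := W) ℓ hbad
    rw [minimalDiscriminantInt_eq hIW] at hd
    exact hΔE ℓ hℓ hd
  have haux : BSTWScope.IsAuxiliaryPrime W 3 19 := by
    refine ⟨by decide, hasMultiplicativeReductionAtPrime_of_intModel hIW 19 (by decide +kernel)
      (by decide +kernel), ?_⟩
    rw [minimalDiscriminantInt_eq hIW,
      padicValInt_eq_of_dvd_of_not_dvd 19 (e := 1) (by decide +kernel) (by decide +kernel)]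
    decide
  refine BSTWScope.hasWitness_of_kronecker W 3 (by decide) 19 haux 359 ⟨by norm_num, ?_, by norm_num⟩
    (by norm_num) (by norm_num) ?_ ?_ (fun _ => by norm_num) ?_
  · exact Int.squarefree_natAbs.mp (by simpa using (by norm_num : Nat.Prime 359).squarefree)
  · intro ℓ hℓ hbad
    have hmem := hbadmem ℓ hℓ hbad
    simp only [hLp, List.mem_cons, List.mem_nil_iff, or_false] at hmem
    rcases hmem with rfl | rfl | rfl <;> decide
  · intro ℓ hℓ hℓq hbad
    have hmem := hbadmem ℓ hℓ hbad
    simp only [hLp, List.mem_cons, List.mem_nil_iff, or_false] at hmem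
    rcases hmem with rfl | rfl | rfl
    · exact absurd rfl hℓq
    · exact ⟨fun h => absurd h (by decide), fun _ => by norm_num⟩
    · exact ⟨fun h => absurd h (by decide), fun _ => by norm_num⟩
  · have h19 : Literature.NumberTheory.QuadraticFields.BinaryQuadraticForm.classNumber (-(359 : ℕ) : ℤ) = 19 := by
      decide +kernel
    rw [h19]; decide

/-- **The Eisenstein half of Kobayashi's main conjecture for `17917b1` at `p = 3`, BOTH signs, MODULO ONLY the
p = 3 tier binder** (`hBSTW : BurungaleSkinnerTianWan2024_thm13_scopedAtThree_OPEN`, PRE resting on (3-ii)♭): the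
scope witness is the kernel theorem `BSTWScope_hasWitness_c17917b1_3`, the class is `classX6_c17917b1_3`. One of the 12 A6
cells of the window at `p = 3` (TARGET §1.1). CONDITIONAL on the PRE binder only; per pair; closes nothing; NOT bookable
on cell verification (RELAY-6). [claim: BurungaleSkinnerTianWan2024, status: under-review]
[cite: Cremona2006, Table 1 (Cremona label 17917b1)] -/
theorem kobayashiLowerDivisibility_c17917b1_3_of_thm13_scopedAtThree_OPEN
    (hBSTW : BurungaleSkinnerTianWan2024_thm13_scopedAtThree_OPEN)
    {W : WeierstrassCurve ℚ} [W.IsElliptic] [W.IsGloballyMinimal]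
    (hWeq : W = ⟨0, 0, 1, -6671, -209767⟩) (ε : ℤˣ) :
    Summit.BirchSwinnertonDyer.Rank1Residual.Supersingular.KobayashiLowerDivisibility W 3 ε :=
  X6.kobayashiLowerDivisibility_of_thm13_scopedAtThree_OPEN W 3 hBSTW rfl (classX6_c17917b1_3 hWeq)
    (BSTWScope_hasWitness_c17917b1_3 hWeq) ε

end Summit.BirchSwinnertonDyer.BirchSwinnertonDyer.Theorems

end
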